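import Summits.BirchSwinnertonDyer.BirchSwinnertonDyer.Theorems.AlignedTransportAtTwoMainConjectureOfRankZeroBSDAtTwoFineRoadKleinCountingInfinite
import Summits.BirchSwinnertonDyer.BirchSwinnertonDyer.Theorems.AlignedTransportAtTwoMainConjectureOfRankZeroBSDAtTwoFineRoadLambdaModP
import Literature.NumberTheory.EllipticCurves.IwasawaAlgebraProofs
import Literature.NumberTheory.EllipticCurves.IwasawaAlgebraDivisibilityProofs
import Mathlib.LinearAlgebra.Matrix.Charpoly.LinearMap
import HarnessLib

/-!
# Route `AlignedTransportAtTwo`, crux C2 `MainConjectureOfRankZeroBSDAtTwo` (stmt-BirchSwinnertonDyer-22298),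
# road (b″): PERFECT DESCENT at `2`, part X — the Λ-ADIC COUNTING LEMMA (PERFECT-DESCENT.md §3 (iii), last line):
# `Hom_{G_∞}(X/2X, V₄)` finite ⟺ `(1 − e₁)X` is `Λ`-torsion with `μ((1 − e₁)X) = 0`

Cell `bsd-f1-sign2`, WIDTH-5 attach seat `bsd-line-att-p3` (gen 5) on line `birth` of crux C2
(`--supports` stmt-BirchSwinnertonDyer-22298; closes nothing). HONEST FRAMING: THEOREMS ONLY — no definition, no
named fact, no instance, no `sorry`; BSD is NOT proved by any of this. The lead's FREE target (c1), SECOND HALF (bus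
2026-08-28T04:46:58Z): «its Λ-form «`Hom_{S₃}(M/2M, V₄)` finite ⟺ `(1 − e₁)M` is Λ-torsion with `μ = 0`» for `M` f.g. over
`Λ = ℤ₂⟦T⟧` with commuting `S₃`-action». Since `2·V₄ = 0`, `Hom(M/2M, V₄) = Hom(M, V₄)`, and that is how it is stated.

Setting: `Λ = IwasawaAlgebra 2 = ℤ₂⟦T⟧`; a group `Q` acting on the Klein four-group `M = V₄` (`#M = 4`, `m + m = 0`)
with a fixed-point-free `σ` (image `C₃`) and possibly a transposition `τ` (image `S₃`), and `Λ`-linearly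
(`SMulCommClass Q Λ X`) on a finitely generated `Λ`-module `X` on which the kernel of the action on `M` acts
trivially. `W := ker(1 + σ + σ²) ≤ X` (a `Λ`-submodule; `= (1 − e₁)X`, `e₁ = 3⁻¹(1 + σ + σ²)`, as `3 ∈ Λˣ`);
`ℓ₍₂₎ = lengthAt Λ · (2)` is the local length at the height-one prime `(2)`, `μ = muInvariant 2`.

## What is proved

* §1 **`exists_notMem_forall_smul_eq_zero_of_quotient`** (any commutative ring `R`, prime `𝔮`, `a ∈ 𝔮`, `Y` f.g.): if
  `(Y/aY)_𝔮 = 0` (every `y` has `s ∉ 𝔮` with `s y ∈ aY`) then `Y_𝔮 = 0` (one `r ∉ 𝔮` kills `Y`) — Nakayama at `𝔮` in the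
  global form the tree's `lengthAt` wants, via Cayley–Hamilton with the ideal `(a)` (Mathlib
  `LinearMap.exists_monic_and_natDegree_eq_and_coeff_mem_pow_and_aeval_eq_zero`).
* §2 **`lengthAt_augIdealP_quotient_eq_zero_iff`**: for `Y` f.g. over `Λ = ℤ_p⟦T⟧`, `ℓ₍ₚ₎(Y/pY) = 0 ⟺ ℓ₍ₚ₎(Y) = 0`;
  **`lengthAt_augIdealP_eq_zero_iff_isTorsion_and_muInvariant_eq_zero`**: `ℓ₍ₚ₎(Y) = 0 ⟺ Y` is `Λ`-torsion with
  `μ(Y) = 0` (`Λ` a domain; `lengthAt_ne_top_of_isTorsion`); with part IX §3 and att-p4 g4's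
  `LambdaModP.lengthAt_two_eq_zero_iff_finite`: **`finite_addMonoidHom_zmodTwo_iff_lengthAt_eq_zero`**:
  `Hom(U, ℤ/2)` finite ⟺ `ℓ₍₂₎(U) = 0`, for `U` f.g. over `ℤ₂⟦T⟧`.
* §3 THE Λ-ADIC COUNTING LEMMA: **`finite_sigmaEquivariant_iff_lengthAt_eq_zero`** (`Hom_σ(X, V₄)` finite ⟺
  `ℓ₍₂₎(W) = 0`), **`finite_equivariant_iff_isTorsion_and_muInvariant_eq_zero_of_no_transposition`** (`Q̄ = C₃`) and
  **`finite_equivariant_iff_isTorsion_and_muInvariant_eq_zero_S3`** (`Q̄ = S₃`):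
  `Hom_Q(X, V₄)` finite ⟺ `W = (1 − e₁)X` is `Λ`-torsion with `μ(W) = 0`.

What this is FOR (PERFECT-DESCENT.md §3 (iii)–(iv)): with `X = X_{Σ-cs}(F_∞)` (the completely-split unramified Iwasawa
module of `F = ℚ(E[2])`, `G_∞ = Gal(F_∞/ℚ_∞) ≤ S₃` acting through conjugation) the left side is `Sel₀(ℚ_∞, E[2])` by
att-p3 g4's inf–res isomorphism (parts II/V) modulo the CFT identification (typing), and the right side is «`μ` of the
norm-minus part» — the `e₁`-part being Ferrero–Washington for `ℚ(√Δ_E)`. Those identifications are NOT here.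

References: J.-P. Serre, *Linear Representations of Finite Groups*, §2.6; H. Matsumura, *Commutative Ring Theory*,
Thm. 2.1 (Cayley–Hamilton with an ideal); L. Washington, *Cyclotomic Fields*, §13.2; PERFECT-DESCENT.md §3 (iii).
-/

set_option autoImplicit false
-- the Theorems namespace of this sub repeats the summit name by design (D-0017 nested layout)
set_option linter.dupNamespace false

noncomputable section

namespace Summit.BirchSwinnertonDyer.BirchSwinnertonDyer.Theorems.AlignedTransportAtTwoFineRoad.PerfectDescent

open Literature.NumberTheory.EllipticCurves Literature.NumberTheory.EllipticCurves.IwasawaAlgebra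
  Literature.NumberTheory.EllipticCurves.Module
open Pointwise Polynomial

/-! ## §1 Nakayama at a prime, global form: `(Y/aY)_𝔮 = 0`, `a ∈ 𝔮` ⟹ `Y_𝔮 = 0` -/

section LocalNakayama

variable {R : Type*} [CommRing R] {Y : Type*} [AddCommGroup Y] [_root_.Module R Y]

/-- **Nakayama at a prime `𝔮`, in global form.** Let `Y` be a finitely generated `R`-module, `𝔮` a prime ideal and
`a ∈ 𝔮`. If every `y ∈ Y` is pushed into `aY` by some `s ∉ 𝔮` (i.e. `(Y/aY)_𝔮 = 0`), then a single `r ∉ 𝔮` kills `Y`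
(i.e. `Y_𝔮 = 0`). Proof: one `t ∉ 𝔮` (a product over generators) has `tY ⊆ aY`; Cayley–Hamilton for `t·1` with the ideal
`(a)` gives `t^n + c₁t^{n-1} + ⋯ + c_n = 0` on `Y` with `cᵢ ∈ (a)ⁱ ⊆ 𝔮`, and `r := t^n + Σ cᵢ t^{n-i} ∉ 𝔮`.
[cite: Matsumura1987, Thm. 2.1 (Cayley–Hamilton with an ideal) and Thm. 2.2 (Nakayama)] -/
theorem exists_notMem_forall_smul_eq_zero_of_quotient [Module.Finite R Y] (𝔮 : Ideal R) [h𝔮 : 𝔮.IsPrime]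
    {a : R} (ha : a ∈ 𝔮) (h : ∀ y : Y, ∃ s ∉ 𝔮, s • y ∈ a • (⊤ : Submodule R Y)) :
    ∃ r ∉ 𝔮, ∀ y : Y, r • y = 0 := by
  classical
  -- one multiplier `t ∉ 𝔮` for all of `Y`
  obtain ⟨G, hG⟩ := Module.Finite.fg_top (R := R) (M := Y)
  choose s hs hsy using h
  let t : R := ∏ g ∈ G, s g
  have ht : t ∉ 𝔮 := by
    refine Finset.prod_induction (fun g : Y ↦ s g) (fun r : R ↦ r ∉ 𝔮) (fun b c hb hc hbc ↦ ?_)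
      (fun h1 ↦ h𝔮.ne_top ((Ideal.eq_top_iff_one 𝔮).mpr h1)) (fun g _ ↦ hs g)
    rcases h𝔮.mem_or_mem hbc with h' | h'
    · exact hb h'
    · exact hc h'
  have htG : ∀ g ∈ G, t • g ∈ a • (⊤ : Submodule R Y) := fun g hg ↦ by
    change (∏ g ∈ G, s g) • g ∈ _
    rw [← Finset.prod_erase_mul G (fun g : Y ↦ s g) hg, mul_smul]
    exact Submodule.smul_mem _ _ (hsy g)
  have htY : ∀ y : Y, t • y ∈ a • (⊤ : Submodule R Y) := by
    intro y
    have hy : y ∈ Submodule.span R (G : Set Y) := by rw [hG]; exact Submodule.mem_top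
    induction hy using Submodule.span_induction with
    | mem g hg => exact htG g hg
    | zero => rw [smul_zero]; exact Submodule.zero_mem _
    | add u v _ _ hu hv => rw [smul_add]; exact Submodule.add_mem _ hu hv
    | smul c u _ hu => rw [smul_comm]; exact Submodule.smul_mem _ c hu
  -- Cayley–Hamilton for `t · 1` with the ideal `(a)`
  let f : Module.End R Y := algebraMap R (Module.End R Y) t
  have hf : ∀ y : Y, f y = t • y := fun y ↦ Module.algebraMap_end_apply R R Y t y
  have hfI : LinearMap.range f ≤ Ideal.span {a} • (⊤ : Submodule R Y) := by
    rintro _ ⟨y, rfl⟩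
    rw [hf, Submodule.ideal_span_singleton_smul]
    exact htY y
  obtain ⟨P, hPmonic, -, hPcoeff, hP⟩ :=
    LinearMap.exists_monic_and_natDegree_eq_and_coeff_mem_pow_and_aeval_eq_zero R f (Ideal.span {a}) hfI
  refine ⟨P.eval t, fun hmem ↦ ?_, fun y ↦ ?_⟩
  · -- `P(t) = t^n + (terms in 𝔮)`
    rw [Polynomial.eval_eq_sum_range, Finset.sum_range_succ, hPmonic.coeff_natDegree, one_mul] at hmem
    have hsum : ∑ k ∈ Finset.range P.natDegree, P.coeff k * t ^ k ∈ 𝔮 := by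
      refine Ideal.sum_mem 𝔮 fun k hk ↦ Ideal.mul_mem_right _ _ ?_
      have hk' : P.natDegree - k ≠ 0 := Nat.sub_ne_zero_of_lt (Finset.mem_range.mp hk)
      exact ((Ideal.pow_le_self hk').trans ((Ideal.span_singleton_le_iff_mem 𝔮).mpr ha)) (hPcoeff k)
    exact ht (h𝔮.mem_of_pow_mem _ ((Ideal.add_mem_iff_right 𝔮 hsum).mp hmem))
  · have hy := LinearMap.congr_fun hP y
    rw [Polynomial.aeval_algebraMap_apply_eq_algebraMap_eval, LinearMap.zero_apply,
      Module.algebraMap_end_apply R R Y] at hy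
    exact hy

end LocalNakayama

/-! ## §2 Over `Λ = ℤ_p⟦T⟧`: `ℓ₍ₚ₎(Y/pY) = 0 ⟺ ℓ₍ₚ₎(Y) = 0 ⟺ Y` torsion with `μ = 0`; `Hom(U, ℤ/2)` finite ⟺ `ℓ₍₂₎(U) = 0` -/

section LengthQuotient

variable (p : ℕ) [Fact p.Prime] {Y : Type*} [AddCommGroup Y] [_root_.Module (IwasawaAlgebra p) Y]

/-- **`ℓ₍ₚ₎(Y/pY) = 0 ⟺ ℓ₍ₚ₎(Y) = 0`** for a finitely generated `Λ = ℤ_p⟦T⟧`-module `Y`: `⟸` since `Y ↠ Y/pY`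
(`lengthAt_quotient_le`); `⟹` is Nakayama at the prime `(p) ∋ p` (`exists_notMem_forall_smul_eq_zero_of_quotient`).
So the prime `(p)` sees a module exactly through its reduction mod `p`. [cite: Washington1997, §13.2] -/
theorem lengthAt_augIdealP_quotient_eq_zero_iff [Module.Finite (IwasawaAlgebra p) Y] :
    lengthAt (IwasawaAlgebra p)
        (Y ⧸ ((p : IwasawaAlgebra p) • (⊤ : Submodule (IwasawaAlgebra p) Y)))
        ⟨augIdealP p, isPrime_augIdealP_holds p⟩ = 0 ↔
      lengthAt (IwasawaAlgebra p) Y ⟨augIdealP p, isPrime_augIdealP_holds p⟩ = 0 := by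
  haveI : (augIdealP p).IsPrime := isPrime_augIdealP_holds p
  have hpmem : (p : IwasawaAlgebra p) ∈ augIdealP p := by
    rw [← map_natCast (PowerSeries.C (R := ℤ_[p])) p]
    exact Ideal.mem_span_singleton_self _
  constructor
  · intro h0
    rw [lengthAt_eq_zero_iff, LocalizedModule.subsingleton_iff] at h0 ⊢
    obtain ⟨r, hr, hr0⟩ := exists_notMem_forall_smul_eq_zero_of_quotient (Y := Y) (augIdealP p) hpmem
      (fun y ↦ by
        obtain ⟨s, hs, hs0⟩ := h0 (Submodule.Quotient.mk y)
        refine ⟨s, hs, ?_⟩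
        rw [← Submodule.Quotient.mk_smul, Submodule.Quotient.mk_eq_zero] at hs0
        exact hs0)
    exact fun y ↦ ⟨r, hr, hr0 y⟩
  · intro h0
    have hle := lengthAt_quotient_le ((p : IwasawaAlgebra p) • (⊤ : Submodule (IwasawaAlgebra p) Y))
      (⟨augIdealP p, isPrime_augIdealP_holds p⟩ : PrimeSpectrum (IwasawaAlgebra p))
    rw [h0] at hle
    exact nonpos_iff_eq_zero.mp hle

/-- **`ℓ₍ₚ₎(Y) = 0 ⟺ Y` is `Λ`-torsion with `μ(Y) = 0`** (finitely generated `Y` over the domain `Λ = ℤ_p⟦T⟧`): `Y₍ₚ₎ = 0`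
says every `y` is killed by some `r ∉ (p)`, in particular by a non-zero-divisor, and `μ = ℓ₍ₚ₎` as a natural number;
conversely a torsion module has finite `ℓ₍ₚ₎` (`lengthAt_ne_top_of_isTorsion`), which vanishes iff its `toNat = μ`
does. This is the phrase «`Λ`-torsion with `μ = 0`» of PERFECT-DESCENT.md §3 (iii). [cite: Washington1997, §13.2] -/
theorem lengthAt_augIdealP_eq_zero_iff_isTorsion_and_muInvariant_eq_zero
    [Module.Finite (IwasawaAlgebra p) Y] :
    lengthAt (IwasawaAlgebra p) Y ⟨augIdealP p, isPrime_augIdealP_holds p⟩ = 0 ↔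
      Module.IsTorsion (IwasawaAlgebra p) Y ∧ muInvariant p Y = 0 := by
  haveI : (augIdealP p).IsPrime := isPrime_augIdealP_holds p
  constructor
  · intro h0
    refine ⟨?_, ?_⟩
    · intro y
      have h0' := h0
      rw [lengthAt_eq_zero_iff, LocalizedModule.subsingleton_iff] at h0'
      obtain ⟨r, hr, hry⟩ := h0' y
      have hr0 : r ≠ 0 := fun h ↦ hr (by rw [h]; exact Ideal.zero_mem _)
      exact ⟨⟨r, mem_nonZeroDivisors_of_ne_zero hr0⟩, hry⟩
    · rw [muInvariant_eq_toNat_lengthAt p Y ⟨augIdealP p, isPrime_augIdealP_holds p⟩ rfl, h0]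
      rfl
  · rintro ⟨hT, hμ⟩
    have hne := lengthAt_ne_top_of_isTorsion p Y hT ⟨augIdealP p, isPrime_augIdealP_holds p⟩ rfl
    rw [muInvariant_eq_toNat_lengthAt p Y ⟨augIdealP p, isPrime_augIdealP_holds p⟩ rfl,
      ENat.toNat_eq_zero] at hμ
    exact hμ.resolve_right hne

end LengthQuotient

section TwoAdic

variable {U : Type*} [AddCommGroup U] [_root_.Module (IwasawaAlgebra 2) U]

/-- **`Hom(U, ℤ/2)` finite ⟺ `ℓ₍₂₎(U) = 0`**, for `U` finitely generated over `Λ = ℤ₂⟦T⟧`: part IX §3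
(`Hom(U, ℤ/2)` finite ⟺ `U/2U` finite) + att-p4 g4 `LambdaModP.lengthAt_two_eq_zero_iff_finite` (`U/2U` is f.g. and
killed by `2`: finite ⟺ `ℓ₍₂₎(U/2U) = 0`) + `lengthAt_augIdealP_quotient_eq_zero_iff` (`⟺ ℓ₍₂₎(U) = 0`).
[cite: Washington1997, §13.2] -/
theorem finite_addMonoidHom_zmodTwo_iff_lengthAt_eq_zero [Module.Finite (IwasawaAlgebra 2) U] :
    Finite (U →+ ZMod 2) ↔
      lengthAt (IwasawaAlgebra 2) U ⟨augIdealP 2, isPrime_augIdealP_holds 2⟩ = 0 := by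
  rw [finite_addMonoidHom_zmodTwo_iff (R := IwasawaAlgebra 2) (U := U)]
  have h2 : ∀ n : U ⧸ ((2 : IwasawaAlgebra 2) • (⊤ : Submodule (IwasawaAlgebra 2) U)), (2 : ℕ) • n = 0 := by
    intro n
    obtain ⟨u, rfl⟩ := Submodule.mkQ_surjective _ n
    rw [← map_nsmul, Submodule.mkQ_apply, Submodule.Quotient.mk_eq_zero,
      ← ofNat_smul_eq_nsmul (R := IwasawaAlgebra 2)]
    exact Submodule.smul_mem_pointwise_smul u (2 : IwasawaAlgebra 2) ⊤ Submodule.mem_top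
  rw [← LambdaModP.lengthAt_two_eq_zero_iff_finite h2]
  have h := lengthAt_augIdealP_quotient_eq_zero_iff 2 (Y := U)
  rw [Nat.cast_ofNat] at h
  exact h

end TwoAdic

/-! ## §3 The Λ-adic counting lemma -/

section LambdaCounting

variable {Q : Type*} [Group Q] {M : Type*} [AddCommGroup M] [DistribMulAction Q M]
  {X : Type*} [AddCommGroup X] [_root_.Module (IwasawaAlgebra 2) X] [DistribMulAction Q X]
  [SMulCommClass Q (IwasawaAlgebra 2) X]

/-- Membership in `W = ker(1 + σ + σ²)`, the `Λ`-submodule cut out by `x + σx + σ²x = 0`. [folklore] -/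
theorem mem_ker_one_add_sigma_add_sigma_sq_iff (σ : Q) (x : X) :
    x ∈ LinearMap.ker (LinearMap.id + DistribSMul.toLinearMap (IwasawaAlgebra 2) X σ +
        (DistribSMul.toLinearMap (IwasawaAlgebra 2) X σ).comp
          (DistribSMul.toLinearMap (IwasawaAlgebra 2) X σ)) ↔
      x + σ • x + σ • (σ • x) = 0 := by
  simp [LinearMap.mem_ker]

/-- **Λ-adic counting lemma, `σ`-form.** For a finitely generated `Λ = ℤ₂⟦T⟧`-module `X` with a `Λ`-linear action of
`Q`, `σ ∈ Q` fixed-point-free on the Klein four-group `M` with `σ³ = 1` on `X`, and `W = ker(1 + σ + σ²) ≤ X`: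
`Hom_σ(X, M) = {f : X →+ M | f σ = σ f}` is finite ⟺ `ℓ₍₂₎(W) = 0`. (Part IX: `Hom_σ(X, M) ≃ (W →+ ℤ/2)`, with
`2x − σx − σ²x ∈ W` checked from `σ³ = 1`; then `finite_addMonoidHom_zmodTwo_iff_lengthAt_eq_zero` for the f.g.
submodule `W` of the Noetherian module `X`.) [cite: SerreGaloisCohomology1997, I §5.1] [cite: Washington1997, §13.2] -/
theorem finite_sigmaEquivariant_iff_lengthAt_eq_zero [Module.Finite (IwasawaAlgebra 2) X]
    (h4 : Nat.card M = 4) (h2 : ∀ m : M, m + m = 0) {σ : Q} (hσ : ∀ m : M, σ • m = m → m = 0)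
    (hσ3 : ∀ x : X, σ • (σ • (σ • x)) = x) :
    Finite {f : X →+ M // ∀ x : X, f (σ • x) = σ • f x} ↔
      lengthAt (IwasawaAlgebra 2)
        (LinearMap.ker (LinearMap.id + DistribSMul.toLinearMap (IwasawaAlgebra 2) X σ +
          (DistribSMul.toLinearMap (IwasawaAlgebra 2) X σ).comp
            (DistribSMul.toLinearMap (IwasawaAlgebra 2) X σ)))
        ⟨augIdealP 2, isPrime_augIdealP_holds 2⟩ = 0 := by
  set W := LinearMap.ker (LinearMap.id + DistribSMul.toLinearMap (IwasawaAlgebra 2) X σ +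
    (DistribSMul.toLinearMap (IwasawaAlgebra 2) X σ).comp
      (DistribSMul.toLinearMap (IwasawaAlgebra 2) X σ)) with hWdef
  have hW : ∀ w : X, w ∈ W → w + σ • w + σ • (σ • w) = 0 := fun w hw ↦
    (mem_ker_one_add_sigma_add_sigma_sq_iff σ w).mp hw
  have hF : ∀ x : X, x + x - σ • x - σ • (σ • x) ∈ W := fun x ↦
    (mem_ker_one_add_sigma_add_sigma_sq_iff σ _).mpr (by
      simp only [smul_add, smul_sub, hσ3]
      abel)
  haveI : IsNoetherian (IwasawaAlgebra 2) X := isNoetherian_of_isNoetherianRing_of_finite _ _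
  rw [finite_sigmaEquivariant_iff_addMonoidHom h4 h2 hσ hσ3 W hW hF]
  exact finite_addMonoidHom_zmodTwo_iff_lengthAt_eq_zero

/-- **Λ-ADIC COUNTING LEMMA, `Q̄ = C₃`** (PERFECT-DESCENT.md §3 (iii) for `G_∞ ≅ C₃`: «read `𝔽₄` for `N`»). Let `Q` act
on the Klein four-group `M` with a fixed-point-free `σ` and NO element acting as a transposition, and `Λ`-linearly on a
finitely generated `Λ = ℤ₂⟦T⟧`-module `X` on which the kernel of the action on `M` acts trivially. Then
`Hom_Q(X, M)` (`= Hom_Q(X/2X, M)`, as `2M = 0`) is FINITE iff `W = ker(1 + σ + σ²) = (1 − e₁)X` is `Λ`-torsion with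
`μ(W) = 0`. [cite: SerreGaloisCohomology1997, I §5.1] [cite: Washington1997, §13.2] -/
theorem finite_equivariant_iff_isTorsion_and_muInvariant_eq_zero_of_no_transposition
    [Module.Finite (IwasawaAlgebra 2) X] (h4 : Nat.card M = 4) (h2 : ∀ m : M, m + m = 0) {σ : Q}
    (hσ : ∀ m : M, σ • m = m → m = 0)
    (hnoT : ∀ g : Q, (∀ m : M, g • m = m) ∨ (∀ m : M, g • m = m → m = 0))
    (hVN : ∀ g : Q, (∀ m : M, g • m = m) → ∀ x : X, g • x = x) :
    Finite {f : X →+ M // ∀ (g : Q) (x : X), f (g • x) = g • f x} ↔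
      Module.IsTorsion (IwasawaAlgebra 2)
          (LinearMap.ker (LinearMap.id + DistribSMul.toLinearMap (IwasawaAlgebra 2) X σ +
            (DistribSMul.toLinearMap (IwasawaAlgebra 2) X σ).comp
              (DistribSMul.toLinearMap (IwasawaAlgebra 2) X σ))) ∧
        muInvariant 2
          (LinearMap.ker (LinearMap.id + DistribSMul.toLinearMap (IwasawaAlgebra 2) X σ +
            (DistribSMul.toLinearMap (IwasawaAlgebra 2) X σ).comp
              (DistribSMul.toLinearMap (IwasawaAlgebra 2) X σ))) = 0 := by
  haveI : IsNoetherian (IwasawaAlgebra 2) X := isNoetherian_of_isNoetherianRing_of_finite _ _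
  rw [finite_equivariant_iff_sigmaEquivariant_of_no_transposition h4 h2 hσ hnoT hVN,
    finite_sigmaEquivariant_iff_lengthAt_eq_zero h4 h2 hσ (smul_smul_smul_eq_self_of_kernel h4 h2 hσ hVN),
    lengthAt_augIdealP_eq_zero_iff_isTorsion_and_muInvariant_eq_zero]

/-- **Λ-ADIC COUNTING LEMMA, `Q̄ = S₃`** (PERFECT-DESCENT.md §3 (iii), «Hence, for `M` finitely generated over `Λ`:
`Hom_{G_∞}(M/2M, N)` finite ⟺ `(1 − e₁)M/2` finite ⟺ `(1 − e₁)M` is `Λ`-torsion with `μ((1 − e₁)M) = 0`»). Let `Q` act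
on the Klein four-group `M` with a fixed-point-free `σ` and a non-trivial `τ` fixing `m₀ ≠ 0` (`Q̄ = Aut(M) ≅ S₃`), and
`Λ`-linearly on a finitely generated `Λ = ℤ₂⟦T⟧`-module `X` on which the kernel of the action on `M` acts trivially.
Then `Hom_Q(X, M)` (`= Hom_Q(X/2X, M)`) is FINITE iff `W = ker(1 + σ + σ²) = (1 − e₁)X` is `Λ`-torsion with `μ(W) = 0`.
The chain: `Hom_Q = Hom_{σ,τ}` finite ⟺ `Hom_σ` finite (part IX, averaging over `τ`) ⟺ `(W →+ ℤ/2)` finite (part IX)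
⟺ `W/2W` finite ⟺ `ℓ₍₂₎(W/2W) = 0` (att-p4 LambdaModP) ⟺ `ℓ₍₂₎(W) = 0` (Nakayama) ⟺ torsion with `μ = 0`.
[cite: SerreGaloisCohomology1997, I §5.1] [cite: Washington1997, §13.2] -/
theorem finite_equivariant_iff_isTorsion_and_muInvariant_eq_zero_S3
    [Module.Finite (IwasawaAlgebra 2) X] (h4 : Nat.card M = 4) (h2 : ∀ m : M, m + m = 0) {σ τ : Q}
    {m₀ : M} (hσ : ∀ m : M, σ • m = m → m = 0) (hm₀ : m₀ ≠ 0) (hτ0 : τ • m₀ = m₀)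
    (hτ : ¬ ∀ m : M, τ • m = m) (hVN : ∀ g : Q, (∀ m : M, g • m = m) → ∀ x : X, g • x = x) :
    Finite {f : X →+ M // ∀ (g : Q) (x : X), f (g • x) = g • f x} ↔
      Module.IsTorsion (IwasawaAlgebra 2)
          (LinearMap.ker (LinearMap.id + DistribSMul.toLinearMap (IwasawaAlgebra 2) X σ +
            (DistribSMul.toLinearMap (IwasawaAlgebra 2) X σ).comp
              (DistribSMul.toLinearMap (IwasawaAlgebra 2) X σ))) ∧
        muInvariant 2
          (LinearMap.ker (LinearMap.id + DistribSMul.toLinearMap (IwasawaAlgebra 2) X σ +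
            (DistribSMul.toLinearMap (IwasawaAlgebra 2) X σ).comp
              (DistribSMul.toLinearMap (IwasawaAlgebra 2) X σ))) = 0 := by
  haveI : IsNoetherian (IwasawaAlgebra 2) X := isNoetherian_of_isNoetherianRing_of_finite _ _
  rw [finite_equivariant_iff_sigmaEquivariant_S3 h4 h2 hσ hm₀ hτ0 hτ hVN,
    finite_sigmaEquivariant_iff_lengthAt_eq_zero h4 h2 hσ (smul_smul_smul_eq_self_of_kernel h4 h2 hσ hVN),
    lengthAt_augIdealP_eq_zero_iff_isTorsion_and_muInvariant_eq_zero]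

end LambdaCounting

end Summit.BirchSwinnertonDyer.BirchSwinnertonDyer.Theorems.AlignedTransportAtTwoFineRoad.PerfectDescent

end
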